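import Mathlib
import Summits.AtomisticToContinuum.Crystallization.Theses.SquareWellLayerCake
import Summits.AtomisticToContinuum.Crystallization.Theorems.SquareWellLayerCakeGapTwelveToBarlowLocalisation

/-!
# `GapTwelveToBarlow` from three sub-cruxes: five-fold sparsity, relaxed rigidity, uniform spacing

Crux `SquareWellLayerCake.GapTwelveToBarlow` (stmt-AtomisticToContinuum-15807).  This file proves the
route-level DECOMPOSITION glue (crux-strategist, 2026-08-17)

  `GapTwelveToBarlow_of_subs : FiveFoldSparse → RelaxedRigidity → UniformSpacing → GapTwelveToBarlow`

along the three-discipline seam of the live line `Cruxes/GapTwelveToBarlow/Lines/Sketch.lean`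
(lead skeleton v2, sha `2c2bc83d1a6c`): the crux (ground states, a.e. Good ⇒ a.e. Barlow-matched
windows at every `(R, ε)`) follows from

* **FiveFoldSparse** (GEOMETRY — curvature-sign rationing; stated for ground-state sequences so
  that an energetic proof is admissible too): along a sequence of Lennard-Jones ground states with
  a.e. Good sites, for every `R > 0` the fraction of sites having a FIVE-FOLD BOND (a bonded pair
  with exactly five common neighbours within distance `1`) within distance `R` tends to `0`.  It is
  the conclusion of the line's derived `stub_fiveFoldSparsity` (there: any sequence, behind the
  landed sign lemma), so it follows from that theorem by dropping one hypothesis.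
* **RelaxedRigidity** (ELASTICITY — the strain half, minimality spent here): ground states in
  which, for every `D`, a.e. site has an all-Good `D`-ball and, for every `R`, a.e. site has no
  five-fold bond within `R`, have a.e. `R`-window two-way `ε`-matched after a linear isometry to a
  RELAXED LAYERED template (triangular layers of spacing `a ∈ [47/50, 1]`, Hägg-coded hole
  positions, free interlayer increments in `[39a/50, 17a/20]`), for every `R > 0`, `ε ∈ (0, 1/4)`.
  It is the line's `stub_relaxedRigidity` with its two statement-hypotheses (extended gap `131/100`,
  sub-configuration floor) removed — the gap constant stays line-internal, the floor is landed.
* **UniformSpacing** (STACKING SELECTION — the hidden uniform-gap half, `K3UniformSpacingNote`,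
  `Negative/PairSumObstruction.not_matched_of_gap_jump`): verbatim the line's `stub_uniformSpacing`.

The only glue used is the landed LOCALISATION `stub_localisation` (a.e. Good ⇒ for every `D`, a.e.
all-Good `D`-ball).  Mathlib + landed theorems; nothing is defined; no named fact is used.
-/

noncomputable section

namespace Summit.AtomisticToContinuum.Crystallization.Theorems.SquareWellLayerCakeGapTwelveToBarlow

open Literature.MathematicalPhysics.StatisticalMechanics
open Summit.AtomisticToContinuum.Crystallization.Theses.SquareWellLayerCake (GapTwelveToBarlow)

/-- **Decomposition glue for the crux `GapTwelveToBarlow`.**  The three hypotheses are, verbatim,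
the route items `FiveFoldSparse`, `RelaxedRigidity`, `UniformSpacing` (children of the split of
stmt-AtomisticToContinuum-15807); the conclusion is the route decl by name.  Proof: localisation
(landed) turns the crux's a.e.-Good hypothesis into a.e. all-Good `D`-balls for every `D`;
five-fold sparsity gives a.e. five-fold-free `R`-balls; relaxed rigidity then uniform spacing give
the Barlow-matched windows. -/
theorem GapTwelveToBarlow_of_subs :
    -- child 1: FiveFoldSparse
    (∀ x : (N : ℕ) → (Fin N → EuclideanSpace ℝ (Fin 3)),
      (∀ N, IsGroundState lennardJones (x N)) →
      Filter.Tendsto (fun N : ℕ => (Nat.card {i : Fin N // ¬ (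
          (∀ j : Fin N, dist (x N i) (x N j) ≤ 11 / 10 → ∀ k : Fin N, k ≠ j → (55 : ℝ) / 57 ≤ dist (x N j) (x N k)) ∧
          (Finset.univ.filter fun j : Fin N => j ≠ i ∧ dist (x N i) (x N j) ≤ 1).card = 12 ∧
          (Finset.univ.filter fun j : Fin N => j ≠ i ∧ dist (x N i) (x N j) ≤ 11 / 10).card ≤ 12)} : ℝ) / N)
        Filter.atTop (nhds 0) →
      ∀ R : ℝ, 0 < R →
        Filter.Tendsto (fun N : ℕ => (Nat.card {i : Fin N // ∃ j k : Fin N,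
          (j ≠ k ∧ dist (x N j) (x N k) ≤ 1 ∧
            (Finset.univ.filter fun l : Fin N =>
              l ≠ j ∧ l ≠ k ∧ dist (x N j) (x N l) ≤ 1 ∧ dist (x N k) (x N l) ≤ 1).card = 5) ∧
          dist (x N i) (x N j) ≤ R} : ℝ) / N)
          Filter.atTop (nhds 0)) →
    -- child 2: RelaxedRigidity
    (∀ x : (N : ℕ) → (Fin N → EuclideanSpace ℝ (Fin 3)),
      (∀ N, IsGroundState lennardJones (x N)) →
      (∀ D : ℝ, 0 < D →
        Filter.Tendsto (fun N : ℕ => (Nat.card {i : Fin N // ¬ (∀ j : Fin N, dist (x N i) (x N j) ≤ D →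
          ((∀ j' : Fin N, dist (x N j) (x N j') ≤ 11 / 10 → ∀ k : Fin N, k ≠ j' → (55 : ℝ) / 57 ≤ dist (x N j') (x N k)) ∧
          (Finset.univ.filter fun j' : Fin N => j' ≠ j ∧ dist (x N j) (x N j') ≤ 1).card = 12 ∧
          (Finset.univ.filter fun j' : Fin N => j' ≠ j ∧ dist (x N j) (x N j') ≤ 11 / 10).card ≤ 12))} : ℝ) / N)
          Filter.atTop (nhds 0)) →
      (∀ R : ℝ, 0 < R →
        Filter.Tendsto (fun N : ℕ => (Nat.card {i : Fin N // ∃ j k : Fin N,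
          (j ≠ k ∧ dist (x N j) (x N k) ≤ 1 ∧
            (Finset.univ.filter fun l : Fin N =>
              l ≠ j ∧ l ≠ k ∧ dist (x N j) (x N l) ≤ 1 ∧ dist (x N k) (x N l) ≤ 1).card = 5) ∧
          dist (x N i) (x N j) ≤ R} : ℝ) / N)
          Filter.atTop (nhds 0)) →
      ∀ R ε : ℝ, 0 < R → 0 < ε → ε < 1 / 4 →
        Filter.Tendsto (fun N : ℕ => (Nat.card {i : Fin N // ¬ (∃ a : ℝ, 47 / 50 ≤ a ∧ a ≤ 1 ∧
          ∃ s : ℤ → ℤ, IsHaggSeq s ∧ ∃ z : ℤ → ℝ,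
            (∀ m : ℤ, 39 / 50 * a ≤ z (m + 1) - z m ∧ z (m + 1) - z m ≤ 17 / 20 * a) ∧
            ∃ m₀ i₀ j₀ : ℤ, ∃ A : EuclideanSpace ℝ (Fin 3) →ₗᵢ[ℝ] EuclideanSpace ℝ (Fin 3),
              (∀ m i' j' : ℤ,
                dist ((i' : ℝ) • triangularVec₁ a + (j' : ℝ) • triangularVec₂ a +
                    (haggLabel s m : ℝ) • barlowOffset a + z m • layerNormal 1)
                  ((i₀ : ℝ) • triangularVec₁ a + (j₀ : ℝ) • triangularVec₂ a +
                    (haggLabel s m₀ : ℝ) • barlowOffset a + z m₀ • layerNormal 1) ≤ R →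
                ∃ j : Fin N, dist (x N j) (x N i + A (
                  ((i' : ℝ) • triangularVec₁ a + (j' : ℝ) • triangularVec₂ a +
                    (haggLabel s m : ℝ) • barlowOffset a + z m • layerNormal 1) -
                  ((i₀ : ℝ) • triangularVec₁ a + (j₀ : ℝ) • triangularVec₂ a +
                    (haggLabel s m₀ : ℝ) • barlowOffset a + z m₀ • layerNormal 1))) ≤ ε) ∧
              (∀ j : Fin N, dist (x N j) (x N i) ≤ R → ∃ m i' j' : ℤ,
                dist (x N j) (x N i + A (
                  ((i' : ℝ) • triangularVec₁ a + (j' : ℝ) • triangularVec₂ a +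
                    (haggLabel s m : ℝ) • barlowOffset a + z m • layerNormal 1) -
                  ((i₀ : ℝ) • triangularVec₁ a + (j₀ : ℝ) • triangularVec₂ a +
                    (haggLabel s m₀ : ℝ) • barlowOffset a + z m₀ • layerNormal 1))) ≤ ε))} : ℝ) / N)
          Filter.atTop (nhds 0)) →
    -- child 3: UniformSpacing
    (∀ x : (N : ℕ) → (Fin N → EuclideanSpace ℝ (Fin 3)),
      (∀ N, IsGroundState lennardJones (x N)) →
      (∀ D : ℝ, 0 < D →
        Filter.Tendsto (fun N : ℕ => (Nat.card {i : Fin N // ¬ (∀ j : Fin N, dist (x N i) (x N j) ≤ D →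
          ((∀ j' : Fin N, dist (x N j) (x N j') ≤ 11 / 10 → ∀ k : Fin N, k ≠ j' → (55 : ℝ) / 57 ≤ dist (x N j') (x N k)) ∧
          (Finset.univ.filter fun j' : Fin N => j' ≠ j ∧ dist (x N j) (x N j') ≤ 1).card = 12 ∧
          (Finset.univ.filter fun j' : Fin N => j' ≠ j ∧ dist (x N j) (x N j') ≤ 11 / 10).card ≤ 12))} : ℝ) / N)
          Filter.atTop (nhds 0)) →
      (∀ R ε : ℝ, 0 < R → 0 < ε → ε < 1 / 4 →
        Filter.Tendsto (fun N : ℕ => (Nat.card {i : Fin N // ¬ (∃ a : ℝ, 47 / 50 ≤ a ∧ a ≤ 1 ∧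
          ∃ s : ℤ → ℤ, IsHaggSeq s ∧ ∃ z : ℤ → ℝ,
            (∀ m : ℤ, 39 / 50 * a ≤ z (m + 1) - z m ∧ z (m + 1) - z m ≤ 17 / 20 * a) ∧
            ∃ m₀ i₀ j₀ : ℤ, ∃ A : EuclideanSpace ℝ (Fin 3) →ₗᵢ[ℝ] EuclideanSpace ℝ (Fin 3),
              (∀ m i' j' : ℤ,
                dist ((i' : ℝ) • triangularVec₁ a + (j' : ℝ) • triangularVec₂ a +
                    (haggLabel s m : ℝ) • barlowOffset a + z m • layerNormal 1)
                  ((i₀ : ℝ) • triangularVec₁ a + (j₀ : ℝ) • triangularVec₂ a +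
                    (haggLabel s m₀ : ℝ) • barlowOffset a + z m₀ • layerNormal 1) ≤ R →
                ∃ j : Fin N, dist (x N j) (x N i + A (
                  ((i' : ℝ) • triangularVec₁ a + (j' : ℝ) • triangularVec₂ a +
                    (haggLabel s m : ℝ) • barlowOffset a + z m • layerNormal 1) -
                  ((i₀ : ℝ) • triangularVec₁ a + (j₀ : ℝ) • triangularVec₂ a +
                    (haggLabel s m₀ : ℝ) • barlowOffset a + z m₀ • layerNormal 1))) ≤ ε) ∧
              (∀ j : Fin N, dist (x N j) (x N i) ≤ R → ∃ m i' j' : ℤ,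
                dist (x N j) (x N i + A (
                  ((i' : ℝ) • triangularVec₁ a + (j' : ℝ) • triangularVec₂ a +
                    (haggLabel s m : ℝ) • barlowOffset a + z m • layerNormal 1) -
                  ((i₀ : ℝ) • triangularVec₁ a + (j₀ : ℝ) • triangularVec₂ a +
                    (haggLabel s m₀ : ℝ) • barlowOffset a + z m₀ • layerNormal 1))) ≤ ε))} : ℝ) / N)
          Filter.atTop (nhds 0)) →
      ∀ R ε : ℝ, 0 < R → 0 < ε → ε < 1 / 4 →
        Filter.Tendsto (fun N : ℕ => (Nat.card {i : Fin N // ¬ (∃ a h : ℝ, 1 / 2 < a ∧ a < 2 ∧ 1 / 2 < h ∧ h < 2 ∧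
          ∃ s : ℤ → ℤ, IsHaggSeq s ∧ ∃ z ∈ barlowStacking a h s,
            ∃ A : EuclideanSpace ℝ (Fin 3) →ₗᵢ[ℝ] EuclideanSpace ℝ (Fin 3),
              (∀ p ∈ barlowStacking a h s, dist p z ≤ R → ∃ j : Fin N, dist (x N j) (x N i + A (p - z)) ≤ ε) ∧
              (∀ j : Fin N, dist (x N j) (x N i) ≤ R →
                ∃ p ∈ barlowStacking a h s, dist (x N j) (x N i + A (p - z)) ≤ ε))} : ℝ) / N)
          Filter.atTop (nhds 0)) →
    GapTwelveToBarlow := by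
  intro hFF hRR hUS x hx hGood R ε hR hε hε'
  have hBalls := fun D hD => stub_localisation x hGood D hD
  exact hUS x hx hBalls (hRR x hx hBalls (hFF x hx hGood)) R ε hR hε hε'

end Summit.AtomisticToContinuum.Crystallization.Theorems.SquareWellLayerCakeGapTwelveToBarlow

end
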